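import Summits.Ventures.HodgeRepro2.T5SU11KernelTwoSidedBoundEdge
import Summits.Ventures.HodgeRepro2.T5SU11KernelUniformBounds
import Summits.Ventures.HodgeRepro2.T5SU11KernelNeumannUniform

/-!
# The `(t, s)`-uniform bounds of the kernel chapter with constants INDEPENDENT of the spectral parameter

Row 615 gives `|K_λ(t, s)| ≤ C Ξ(t) Ξ(s)` on `{max(t, s) ≥ a}` with one constant `C = C(a)` for all `λ > 1`. Re-running rows
601–602 with this constant removes the dependence on `λ₂` from their constants:

* `exists_kernel_comp_le_uniform_lam` — **`|K_λ^{∘(n+1)}(t, s)| ≤ C Ξ(s) Ξ(t)/((λ − 1)²)ⁿ`** for all `λ > 1`, `t > 0`, `s ≥ a`, `n`;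
* `exists_abs_kernel_sub_le_uniform_lam` — **`|K_λ(t, s) − K_{λ₂}(t, s)| ≤ |μ − μ₂| C Ξ(s) Ξ(t)/(λ − 1)²`** for all `λ, λ₂ > 1`;
* `exists_kernel_neumann_remainder_le_uniform_lam` — **the kernel's Neumann remainder
  `|K_λ(t, s) − Σ_{k<n+2} (μ − μ₂)^k K_{λ₂}^{∘(k+1)}(t, s)| ≤ |μ − μ₂| C Ξ(s) Ξ(t)/(λ − 1)² · (|μ − μ₂|/(λ₂ − 1)²)^{n+1}`** with `C = C(a)`
  for all `λ, λ₂ > 1`.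

The remaining dependence on the spectral parameters is the explicit one through `(λ − 1)²` and `(λ₂ − 1)²` — the distance
to the bottom of the spectrum — which is sharp (rows 607–608). Nothing is claimed about (N).

Blind lane: Mathlib + the HodgeRepro2 prefix only; no sorry; axioms ⊆ {propext, Classical.choice,
Quot.sound}.
-/

namespace Summit.Ventures.HodgeRepro2.T5SU11KernelUniformBoundsLam

open Filter Topology MeasureTheory
open Set (Ioi Ioc)
open T5SU11Cartan T5SU11SphericalFunction T5SU11SphericalBounds T5SU11SphericalDecay T5SU11RadialGreenKernel
  T5SU11RadialGreenImproper T5SU11KernelDifferenceRegularity T5SU11ResolventGroundStateWeight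
  T5SU11WeightedSpaceGroundState T5SU11ResolventNeumannUniform T5SU11ResolventIterateHilbert
  T5SU11KernelTwoSidedBoundEdge T5SU11KernelNeumannUniform

section measure

variable [MeasurableSpace Circle] [BorelSpace Circle]

/-- **The composed kernels with a constant independent of `λ`**: for every `a > 0` there is `C > 0` with
`|K_λ^{∘(n+1)}(t, s)| ≤ C Ξ(s) Ξ(t)/((λ − 1)²)ⁿ` for all `λ > 1`, `n`, `t > 0` and `s ≥ a`. -/
theorem exists_kernel_comp_le_uniform_lam {a : ℝ} (ha : 0 < a) :
    ∃ C : ℝ, 0 < C ∧ ∀ lam, 1 < lam → ∀ n : ℕ, ∀ t s, 0 < t → a ≤ s →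
      |((greenSolI (fun t => sph lam (hyp t)) (sphDecay lam))^[n] (fun r => sphGreenKernel lam r s)) t|
        ≤ C * sph 1 (hyp s) * sph 1 (hyp t) / ((lam - 1) ^ 2) ^ n := by
  obtain ⟨C, hC, hC'⟩ := exists_kernel_source_le_mul_sph_one_uniform_lam ha
  refine ⟨C, hC, fun lam hlam n t s ht hs => ?_⟩
  have hs0 : 0 < s := lt_of_lt_of_le ha hs
  have hg := kernel_source_continuousOn hlam hs0
  exact (iterate_mem_weighted_one hlam hg (hC' lam hlam s hs) n).2 t ht

/-- **The Lipschitz bound in `μ` with a constant independent of both spectral parameters**: for every `a > 0` there is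
`C > 0` with `|K_λ(t, s) − K_{λ₂}(t, s)| ≤ |μ − μ₂| · C Ξ(s) Ξ(t)/(λ − 1)²` for all `λ, λ₂ > 1`, `t > 0`, `s ≥ a`. -/
theorem exists_abs_kernel_sub_le_uniform_lam {a : ℝ} (ha : 0 < a) :
    ∃ C : ℝ, 0 < C ∧ ∀ lam lam₂, 1 < lam → 1 < lam₂ → ∀ t s, 0 < t → a ≤ s →
      |sphGreenKernel lam t s - sphGreenKernel lam₂ t s|
        ≤ |lam * (lam - 2) - lam₂ * (lam₂ - 2)| * (C * sph 1 (hyp s) * sph 1 (hyp t) / (lam - 1) ^ 2) := by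
  obtain ⟨C, hC, hC'⟩ := exists_kernel_source_le_mul_sph_one_uniform_lam ha
  refine ⟨C, hC, fun lam lam₂ hlam hlam₂ t s ht hs => ?_⟩
  have hs0 : 0 < s := lt_of_lt_of_le ha hs
  have hg := kernel_source_continuousOn hlam₂ hs0
  rw [kernel_sub_kernel_eq_greenSolI hlam hlam₂ hs0 ht, abs_mul]
  exact mul_le_mul_of_nonneg_left (abs_greenSolI_le_mul_sph_one' hlam hg (hC' lam₂ hlam₂ s hs) ht) (abs_nonneg _)

/-- **The kernel's Neumann remainder with a constant independent of both spectral parameters**: for every `a > 0` there is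
`C > 0` with `|K_λ(t, s) − Σ_{k<n+2} (μ − μ₂)^k K_{λ₂}^{∘(k+1)}(t, s)| ≤ |μ − μ₂| · C Ξ(s) Ξ(t)/(λ − 1)² · (|μ − μ₂|/(λ₂ − 1)²)^{n+1}`
for all `λ, λ₂ > 1`, `t > 0`, `s ≥ a` and `n`. -/
theorem exists_kernel_neumann_remainder_le_uniform_lam {a : ℝ} (ha : 0 < a) :
    ∃ C : ℝ, 0 < C ∧ ∀ lam lam₂, 1 < lam → 1 < lam₂ → ∀ t s, 0 < t → a ≤ s → ∀ n : ℕ,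
      |sphGreenKernel lam t s - ∑ k ∈ Finset.range (n + 2), (lam * (lam - 2) - lam₂ * (lam₂ - 2)) ^ k
          * ((greenSolI (fun t => sph lam₂ (hyp t)) (sphDecay lam₂))^[k] (fun r => sphGreenKernel lam₂ r s)) t|
        ≤ |lam * (lam - 2) - lam₂ * (lam₂ - 2)| * (C * sph 1 (hyp s) * sph 1 (hyp t) / (lam - 1) ^ 2
          * (|lam * (lam - 2) - lam₂ * (lam₂ - 2)| / (lam₂ - 1) ^ 2) ^ (n + 1)) := by
  obtain ⟨C, hC, hC'⟩ := exists_kernel_source_le_mul_sph_one_uniform_lam ha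
  refine ⟨C, hC, fun lam lam₂ hlam hlam₂ t s ht hs n => ?_⟩
  have hs0 : 0 < s := lt_of_lt_of_le ha hs
  have hg := kernel_source_continuousOn hlam₂ hs0
  have h := neumann_remainder_le hlam hlam₂ hg (hC' lam₂ hlam₂ s hs) n ht
  rw [kernel_sub_partial_sum_eq hlam hlam₂ hs0 n ht, abs_mul]
  exact mul_le_mul_of_nonneg_left h (abs_nonneg _)

end measure

end Summit.Ventures.HodgeRepro2.T5SU11KernelUniformBoundsLam
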